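import Literature.MathematicalPhysics.QuantumLattice.EmeryThreeBandGeneralPairForm
import Literature.MathematicalPhysics.QuantumLattice.HubbardOpenBoxGeneralPairClusterPSD
import HarnessLib

/-!
# THE `CuO₄` CLUSTER DICTIONARY: the uniformly reweighted three-band Hamiltonian on the plus window `W₅`, relabelled onto `Fin 1 ×ₗ Fin 5`,
# IS `hubbardOpenBoxGP 1 5 τ υ ν` with explicit tables — so kernel sector floors of `h^G` give `H^w_{W₅}[emeryInteraction θ] − q₀·1 ⪰ 0`

Topic `Literature/MathematicalPhysics/QuantumLattice` (family `hubbard`; crew hubbard-fast S2 (iv) «three-band Emery boxes»). The last link between the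
kernel cluster device (hubbard-box-p2: `HubbardOpenBoxGeneralPairCluster(Oracle/PSD)`, sector floors of `hubbardOpenBoxGP a b τ υ ν` on `Fin a ×ₗ Fin b`)
and the three-band floor doors (`le_emeryEnergyDensity_of_cuO4Certificate`, hubbard-downfold-mod-4's
`emeryBoxLa214v122_cuprate_energyFloor54_of_cuO4Certificates`, hypothesis `hq : PosSemidef (H^w_{W₅}[emeryInteraction θᵢ] + G − q₀•1)`):

* §1 the five sites of the plus in LEXICOGRAPHIC order `plusSite = ((1,2), (2,1), (2,2), (2,3), (3,2))` = (O_x, O_y, Cu, O_y, O_x) — the ranks `0..4` of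
  mod-4's order sheet `La214_cuO4plus_corners_v2_lex.json` — and the site bijection **`cuO4SiteEquiv : PolySite emeryCuO4Window ≃ Fin 1 ×ₗ Fin 5`**;
* §2 **`relabel_cuO4_reweight_emeryInteraction`**: for EVERY weight `w` and `θ ∈ ℝ¹⁴`,
  `relabel (Orb.mapEquiv cuO4SiteEquiv) (H^w_{W₅}[emeryInteraction θ]) = hubbardOpenBoxGP 1 5 (emeryTau w θ W₅ ∘ f⁻¹) (emeryUps … ∘ f⁻¹) (emeryNu … ∘ f⁻¹)`
  (`EmeryThreeBandGeneralPairForm` + the relabelling law), `emeryTau` symmetric; hence **`posSemidef_cuO4_reweight_sub_of_gpSectorFloors`**: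
  `(∀ k ≤ 10, q ≤ E₀(h^G, k)) ⇒ PosSemidef (H^w_{W₅}[emeryInteraction θ] − q•1)` (box-p2's `posSemidef_hubbardOpenBoxGP_sub_smul_one_of_sectors` + `posSemidef_relabel`);
* §3 THE UNIFORM-WEIGHT TABLES (`uniformPeriodicWeight liebPeriods W₅ M`: placement counts `1` for the eight bonds and the Cu site, `2` for the four O sites —
  kernel-decided): **`plusTau θ M`, `plusUps θ M`, `plusNu θ M`** on ranks `k, l ∈ Fin 5`:
  `τ = M·` (`{2,4} ↦ θ₀`, `{0,2} ↦ θ₁`, `{2,3} ↦ θ₂`, `{1,2} ↦ θ₃`, `{0,3} ↦ θ₄`, `{3,4} ↦ θ₅`, `{0,1} ↦ θ₆`, `{1,4} ↦ θ₇`, else `0`),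
  `υ = M·(θ₁₂/2, θ₁₃/2, θ₁₁, θ₁₃/2, θ₁₂/2)`, `ν = M·(θ₉/2, θ₁₀/2, θ₈, θ₁₀/2, θ₉/2)`; `emeryTau/Ups/Nu_uniform_cuO4` identify them with §2's tables;
* §4 **`posSemidef_cuO4_uniform_sub_of_gpSectorFloors (θ) (hM : M ≠ 0?) …`**: `(∀ k ≤ 10, q ≤ groundEnergy (hubbardOpenBoxGP 1 5 (plusTau θ M) (plusUps θ M) (plusNu θ M)) k)
  ⇒ PosSemidef (H^{w_M}_{W₅}[emeryInteraction θ] − q•1)` — with `θ = emeryLine cuprateSigns (la214v122xCorner i) + μᵢ•levelDir` this is literally the `hq i`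
  (with `G i = 0`) of the La₂CuO₄ order, and box-p2's integer tables `/Q` are `plusTau/Ups/Nu` at those `θ` (`M = 2`, `Q = 100`).

Everything is PROVED (0 sorry); definitions with bodies: `plusSite`, `plusRank`, `cuO4SiteEquiv`, `plusTau`, `plusUps`, `plusNu`. HONEST SCOPE: plumbing; no number.

## Tree / Mathlib search

REUSED: `localHamiltonian_reweight_emeryInteraction_eq_generalPair`, `relabel_generalPairHamiltonian`, `hubbardOpenBoxGP_eq_generalPairHamiltonian`, `emeryTau/Ups/Nu`,
`emeryAtomPairCoef`, `hopInd`, `emeryAtomCoset/Vec` (`EmeryThreeBandGeneralPairForm`); `hubbardOpenBoxGP`, `posSemidef_hubbardOpenBoxGP_sub_smul_one_of_sectors`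
(`HubbardOpenBoxGeneralPairCluster(PSD)`, hubbard-box-p2); `posSemidef_relabel`, `relabel_symm_relabel` (`HubbardNNNHoppingClusterEmbedding`, `FockRelabel`);
`emeryCuO4Window`, `mem_emeryCuO4Window_iff` (`EmeryThreeBandCuO4WindowFloor`); `uniformPeriodicWeight`, `superlatPlacementCount` (`WeightedOpenClusterUniformWeightsPeriodic`).

## References

* R. Valentí, J. Stolze, P. J. Hirschfeld, Phys. Rev. B 43 (1991) 13743, §II. [cite: ValentiStolzeHirschfeld1991, §II]
* E. Pavarini et al., Phys. Rev. Lett. 87 (2001) 047003, eq. (1). [cite: PavariniEtAl2001, eq. (1)]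
* I. Kull, N. Schuch, B. Dive, M. Navascués, Phys. Rev. X 14 (2024) 021008, §5.3 (sector certificates ⇒ operator inequality). [cite: KullEtAl2024, §5.3]
-/

noncomputable section

open scoped ComplexOrder BigOperators
open Finset

namespace Literature.MathematicalPhysics.QuantumLattice

open Matrix HubbardWave0 Literature.Probability.LatticeModels ThermodynamicLimit ClusterLowerBound

/-! ### §1. The five sites of the plus in lexicographic order and the site bijection -/

/-- **The sites of the plus by rank** (lexicographic order of `ℤ²`): `0 ↦ (1,2)` (O_x), `1 ↦ (2,1)` (O_y), `2 ↦ (2,2)` (Cu), `3 ↦ (2,3)` (O_y), `4 ↦ (3,2)` (O_x).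
[cite: ValentiStolzeHirschfeld1991, §II] -/
def plusSite : Fin 5 → Site 2 := ![![1, 2], ![2, 1], ![2, 2], ![2, 3], ![3, 2]]

/-- Every ranked site lies in the plus window. [cite: ValentiStolzeHirschfeld1991, §II] -/
theorem plusSite_mem (k : Fin 5) : plusSite k ∈ emeryCuO4Window := by
  fin_cases k <;> decide

/-- **The rank of a site** (`0` off the four listed non-first sites; only used on the window). [cite: ValentiStolzeHirschfeld1991, §II] -/
def plusRank (x : Site 2) : Fin 5 :=
  if x = plusSite 1 then 1 else if x = plusSite 2 then 2 else if x = plusSite 3 then 3 else if x = plusSite 4 then 4 else 0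

/-- The rank of a ranked site. [cite: ValentiStolzeHirschfeld1991, §II] -/
theorem plusRank_plusSite (k : Fin 5) : plusRank (plusSite k) = k := by
  fin_cases k <;> decide

/-- Every site of the plus is a ranked site. [cite: ValentiStolzeHirschfeld1991, §II] -/
theorem plusSite_plusRank {x : Site 2} (hx : x ∈ emeryCuO4Window) : plusSite (plusRank x) = x := by
  rw [mem_emeryCuO4Window_iff, Fin.forall_fin_two] at hx
  obtain ⟨⟨⟨h0, h0'⟩, ⟨h1, h1'⟩⟩, h⟩ := hx
  have hx2 : x = ![x 0, x 1] := by funext i; fin_cases i <;> rfl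
  -- the five coordinate cases
  have key : (x 0 = 1 ∧ x 1 = 2) ∨ (x 0 = 2 ∧ x 1 = 1) ∨ (x 0 = 2 ∧ x 1 = 2) ∨ (x 0 = 2 ∧ x 1 = 3) ∨ (x 0 = 3 ∧ x 1 = 2) := by
    rcases h with ⟨h2 | h2, h3, h4⟩ <;> omega
  rcases key with ⟨a, b⟩ | ⟨a, b⟩ | ⟨a, b⟩ | ⟨a, b⟩ | ⟨a, b⟩ <;>
    · rw [hx2, a, b]; decide

/-- **The site bijection `PolySite W₅ ≃ Fin 1 ×ₗ Fin 5`** by rank (order-preserving for the lexicographic orders, though only bijectivity is used).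
[cite: ValentiStolzeHirschfeld1991, §II] -/
def cuO4SiteEquiv : PolySite emeryCuO4Window ≃ Fin 1 ×ₗ Fin 5 where
  toFun p := toLex (0, plusRank (ofLex p.1))
  invFun i := PolySite.pt (plusSite (ofLex i).2) (plusSite_mem _)
  left_inv p := by
    apply Subtype.ext
    show toLex (plusSite (plusRank (ofLex p.1))) = p.1
    rw [plusSite_plusRank (PolySite.ofLex_mem p), toLex_ofLex]
  right_inv i := by
    show toLex ((0 : Fin 1), plusRank (plusSite (ofLex i).2)) = i
    rw [plusRank_plusSite, show (0 : Fin 1) = (ofLex i).1 from Subsingleton.elim _ _, Prod.mk.eta, toLex_ofLex]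

/-- The inverse bijection sends rank `k` to the site `plusSite k`. [cite: ValentiStolzeHirschfeld1991, §II] -/
theorem cuO4SiteEquiv_symm_apply (i : Fin 1 ×ₗ Fin 5) : ofLex (cuO4SiteEquiv.symm i).1 = plusSite (ofLex i).2 := rfl

/-! ### §2. The relabelled cluster Hamiltonian is `hubbardOpenBoxGP 1 5`; sector floors give the window certificate -/

/-- **`emeryTau` is symmetric** (the pair indicator and the pair weight are). [cite: ValentiStolzeHirschfeld1991, §II] -/
theorem emeryTau_symm (w : Finset (Site 2) → ℝ) (θ : Fin 14 → ℝ) (Λ : Finset (Site 2)) (p p' : PolySite Λ) :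
    emeryTau w θ Λ p p' = emeryTau w θ Λ p' p := by
  unfold emeryTau emeryAtomPairCoef hopInd
  refine Finset.sum_congr rfl fun a _ => ?_
  rw [Finset.pair_comm]
  congr 2
  split_ifs <;> norm_num

/-- **THE DICTIONARY (any weight)**: relabelled onto `Fin 1 ×ₗ Fin 5` by rank, the reweighted three-band Hamiltonian on the plus is the general-pair cluster
`hubbardOpenBoxGP 1 5` with the tables `emeryTau/Ups/Nu ∘ f⁻¹`. [cite: ValentiStolzeHirschfeld1991, §II] [cite: PavariniEtAl2001, eq. (1)] -/
theorem relabel_cuO4_reweight_emeryInteraction (w : Finset (Site 2) → ℝ) (θ : Fin 14 → ℝ) :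
    relabel (Orb.mapEquiv cuO4SiteEquiv)
        ((⟨fun X => (w X : ℂ) • (emeryInteraction θ).Φ X⟩ : FermionInteraction 2).localHamiltonian emeryCuO4Window) =
      hubbardOpenBoxGP 1 5 (fun i j => emeryTau w θ emeryCuO4Window (cuO4SiteEquiv.symm i) (cuO4SiteEquiv.symm j))
        (fun i => emeryUps w θ emeryCuO4Window (cuO4SiteEquiv.symm i)) (fun i => emeryNu w θ emeryCuO4Window (cuO4SiteEquiv.symm i)) := by
  rw [localHamiltonian_reweight_emeryInteraction_eq_generalPair, relabel_generalPairHamiltonian, hubbardOpenBoxGP_eq_generalPairHamiltonian]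

/-- `relabel e 1 = 1`, generic rewriting form (at concrete orbital types `map_one` would have to re-synthesise the matrix-algebra instances).
[folklore] -/
private theorem relabel_one_generic {ι ι' : Type*} [LinearOrder ι] [Fintype ι] [LinearOrder ι'] [Fintype ι']
    (e : ι ≃ ι') : relabel e (1 : Matrix (Finset ι) (Finset ι) ℂ) = 1 :=
  map_one (relabel e)

/-- **PSD transport**: an operator inequality for the relabelled cluster is one for the window Hamiltonian. [cite: KullEtAl2024, §5.3] -/
theorem posSemidef_cuO4_reweight_sub_of_gp (w : Finset (Site 2) → ℝ) (θ : Fin 14 → ℝ) {q : ℝ}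
    (h : (hubbardOpenBoxGP 1 5 (fun i j => emeryTau w θ emeryCuO4Window (cuO4SiteEquiv.symm i) (cuO4SiteEquiv.symm j))
        (fun i => emeryUps w θ emeryCuO4Window (cuO4SiteEquiv.symm i)) (fun i => emeryNu w θ emeryCuO4Window (cuO4SiteEquiv.symm i)) -
        (q : ℂ) • (1 : Matrix (Finset (Orb (Fin 1 ×ₗ Fin 5))) (Finset (Orb (Fin 1 ×ₗ Fin 5))) ℂ)).PosSemidef) :
    (((⟨fun X => (w X : ℂ) • (emeryInteraction θ).Φ X⟩ : FermionInteraction 2).localHamiltonian emeryCuO4Window) -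
      (q : ℂ) • (1 : FermionOp emeryCuO4Window)).PosSemidef := by
  have h' := posSemidef_relabel (Orb.mapEquiv cuO4SiteEquiv).symm h
  rw [map_sub, map_smul, relabel_one_generic, ← relabel_cuO4_reweight_emeryInteraction, relabel_symm_relabel] at h'
  exact h'

/-- **SECTOR FLOORS ⇒ WINDOW CERTIFICATE (any weight)**: `q ≤ E₀(h^G, k)` for every `k ≤ 10` on the relabelled cluster gives
`H^w_{W₅}[emeryInteraction θ] − q•1 ⪰ 0`. [cite: KullEtAl2024, §5.3] -/
theorem posSemidef_cuO4_reweight_sub_of_gpSectorFloors (w : Finset (Site 2) → ℝ) (θ : Fin 14 → ℝ) {q : ℝ}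
    (hq : ∀ k ≤ 10, q ≤ groundEnergy (hubbardOpenBoxGP 1 5 (fun i j => emeryTau w θ emeryCuO4Window (cuO4SiteEquiv.symm i) (cuO4SiteEquiv.symm j))
        (fun i => emeryUps w θ emeryCuO4Window (cuO4SiteEquiv.symm i)) (fun i => emeryNu w θ emeryCuO4Window (cuO4SiteEquiv.symm i))) k) :
    (((⟨fun X => (w X : ℂ) • (emeryInteraction θ).Φ X⟩ : FermionInteraction 2).localHamiltonian emeryCuO4Window) -
      (q : ℂ) • (1 : FermionOp emeryCuO4Window)).PosSemidef :=
  posSemidef_cuO4_reweight_sub_of_gp w θ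
    (posSemidef_hubbardOpenBoxGP_sub_smul_one_of_sectors _ (fun i j => emeryTau_symm w θ _ _ _) _ _ fun k hk => hq k (by simpa using hk))


/-! ### §3. The uniform-weight tables on the plus -/

section Tables

/-- Integer twin of the bond indicator `hopInd`. [cite: ValentiStolzeHirschfeld1991, §II] -/
def hopIndNat (q : Fin 2 → ℕ) (c v x y : Site 2) : ℕ :=
  (if y = x + v ∧ InCoset q c x then 1 else 0) + (if x = y + v ∧ InCoset q c y then 1 else 0)

/-- `hopInd` is the cast of its integer twin. [cite: ValentiStolzeHirschfeld1991, §II] -/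
theorem hopInd_eq_cast (q : Fin 2 → ℕ) (c v x y : Site 2) : hopInd q c v x y = (hopIndNat q c v x y : ℝ) := by
  unfold hopInd hopIndNat
  split_ifs <;> norm_num

/-- Integer twins of the atoms' repulsion / site-energy amplitudes. [cite: PavariniEtAl2001, eq. (1)] -/
def emeryAtomUNat : Fin 14 → ℕ := ![0, 0, 0, 0, 0, 0, 0, 0, 0, 0, 0, 1, 1, 1]

/-- Integer twins of the atoms' site-energy amplitudes. [cite: PavariniEtAl2001, eq. (1)] -/
def emeryAtomEpsNat : Fin 14 → ℕ := ![0, 0, 0, 0, 0, 0, 0, 0, 1, 1, 1, 0, 0, 0]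

/-- `emeryAtomU` is the cast of its integer twin. [cite: PavariniEtAl2001, eq. (1)] -/
theorem emeryAtomU_eq_cast (a : Fin 14) : emeryAtomU a = (emeryAtomUNat a : ℝ) := by
  fin_cases a <;> simp [emeryAtomU, emeryAtomUNat]

/-- `emeryAtomEps` is the cast of its integer twin. [cite: PavariniEtAl2001, eq. (1)] -/
theorem emeryAtomEps_eq_cast (a : Fin 14) : emeryAtomEps a = (emeryAtomEpsNat a : ℝ) := by
  fin_cases a <;> simp [emeryAtomEps, emeryAtomEpsNat]

/-- **The bond class joining two ranks of the plus** (`8` = none): `{2,4} ↦ 0` (Cu–O_x along `+e₁`), `{0,2} ↦ 1`, `{2,3} ↦ 2`, `{1,2} ↦ 3`, `{0,3} ↦ 4`,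
`{3,4} ↦ 5`, `{0,1} ↦ 6`, `{1,4} ↦ 7`. [cite: PavariniEtAl2001, eq. (1)] -/
def plusAtomOf : Fin 5 → Fin 5 → Fin 14 :=
  ![![8, 6, 1, 4, 8], ![6, 8, 3, 8, 7], ![1, 3, 8, 2, 0], ![4, 8, 2, 8, 5], ![8, 7, 0, 5, 8]]

/-- The repulsion atom living on each rank (`12` on O_x, `13` on O_y, `11` on Cu). [cite: PavariniEtAl2001, eq. (1)] -/
def plusUAtomOf : Fin 5 → Fin 14 := ![12, 13, 11, 13, 12]

/-- The site-energy atom living on each rank (`9` on O_x, `10` on O_y, `8` on Cu). [cite: PavariniEtAl2001, eq. (1)] -/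
def plusEpsAtomOf : Fin 5 → Fin 14 := ![9, 10, 8, 10, 9]

/-- **THE BOND TABLE OF THE PLUS** (kernel-decided): between ranks `k, l` exactly the atom `plusAtomOf k l` has a non-zero (unit) bond indicator.
[cite: PavariniEtAl2001, eq. (1)] -/
theorem hopIndNat_plus (a : Fin 14) (k l : Fin 5) :
    (if a.1 < 8 then hopIndNat liebPeriods (emeryAtomCoset a) (emeryAtomVec a) (plusSite k) (plusSite l) else 0) =
      if a = plusAtomOf k l ∧ (plusAtomOf k l).1 < 8 then 1 else 0 := by
  revert a k l
  decide

/-- **THE REPULSION TABLE OF THE PLUS** (kernel-decided). [cite: PavariniEtAl2001, eq. (1)] -/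
theorem emeryAtomUNat_mul_coset_plus (a : Fin 14) (k : Fin 5) :
    emeryAtomUNat a * (if InCoset liebPeriods (emeryAtomCoset a) (plusSite k) then 1 else 0) = if a = plusUAtomOf k then 1 else 0 := by
  revert a k
  decide

/-- **THE SITE-ENERGY TABLE OF THE PLUS** (kernel-decided). [cite: PavariniEtAl2001, eq. (1)] -/
theorem emeryAtomEpsNat_mul_coset_plus (a : Fin 14) (k : Fin 5) :
    emeryAtomEpsNat a * (if InCoset liebPeriods (emeryAtomCoset a) (plusSite k) then 1 else 0) = if a = plusEpsAtomOf k then 1 else 0 := by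
  revert a k
  decide

/-- **THE PLACEMENT COUNTS OF THE PLUS** (kernel-decided): every pair of distinct ranks has ONE even translate inside the plus; the Cu site one,
each O site two. [cite: ValentiStolzeHirschfeld1991, §II] -/
theorem superlatPlacementCount_plus_pair (k l : Fin 5) :
    superlatPlacementCount liebPeriods emeryCuO4Window ({plusSite k, plusSite l} : Finset (Site 2)) =
      if k = l then (![2, 2, 1, 2, 2] : Fin 5 → ℕ) k else 1 := by
  revert k l
  decide

/-- The singleton counts. [cite: ValentiStolzeHirschfeld1991, §II] -/
theorem superlatPlacementCount_plus_single (k : Fin 5) :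
    superlatPlacementCount liebPeriods emeryCuO4Window ({plusSite k} : Finset (Site 2)) = (![2, 2, 1, 2, 2] : Fin 5 → ℕ) k := by
  revert k
  decide

variable (θ : Fin 14 → ℝ) (M : ℝ)

/-- **The pair table `τ` of the uniformly weighted plus** (mass `M`), by ranks. [cite: ValentiStolzeHirschfeld1991, §II] -/
def plusTau (i j : Fin 1 ×ₗ Fin 5) : ℝ :=
  M * (![![0, θ 6, θ 1, θ 4, 0], ![θ 6, 0, θ 3, 0, θ 7], ![θ 1, θ 3, 0, θ 2, θ 0], ![θ 4, 0, θ 2, 0, θ 5], ![0, θ 7, θ 0, θ 5, 0]] :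
    Fin 5 → Fin 5 → ℝ) (ofLex i).2 (ofLex j).2

/-- **The repulsion table `υ` of the uniformly weighted plus**: `M·(θ₁₂/2, θ₁₃/2, θ₁₁, θ₁₃/2, θ₁₂/2)`. [cite: ValentiStolzeHirschfeld1991, §II] -/
def plusUps (i : Fin 1 ×ₗ Fin 5) : ℝ := M * (![θ 12 / 2, θ 13 / 2, θ 11, θ 13 / 2, θ 12 / 2] : Fin 5 → ℝ) (ofLex i).2

/-- **The site-energy table `ν` of the uniformly weighted plus**: `M·(θ₉/2, θ₁₀/2, θ₈, θ₁₀/2, θ₉/2)`. [cite: ValentiStolzeHirschfeld1991, §II] -/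
def plusNu (i : Fin 1 ×ₗ Fin 5) : ℝ := M * (![θ 9 / 2, θ 10 / 2, θ 8, θ 10 / 2, θ 9 / 2] : Fin 5 → ℝ) (ofLex i).2

/-- Every element of `Fin 1 ×ₗ Fin 5` is `(0, k)`. [folklore] -/
private theorem lex_eq_toLex (i : Fin 1 ×ₗ Fin 5) : i = toLex ((0 : Fin 1), (ofLex i).2) := by
  rw [show (0 : Fin 1) = (ofLex i).1 from Subsingleton.elim _ _, Prod.mk.eta, toLex_ofLex]

/-- **The pair coefficients of the uniformly weighted plus are the table `plusTau`.** [cite: ValentiStolzeHirschfeld1991, §II] -/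
theorem emeryTau_uniform_plus (i j : Fin 1 ×ₗ Fin 5) :
    emeryTau (uniformPeriodicWeight liebPeriods emeryCuO4Window M) θ emeryCuO4Window (cuO4SiteEquiv.symm i) (cuO4SiteEquiv.symm j) = plusTau θ M i j := by
  rw [lex_eq_toLex i, lex_eq_toLex j]
  generalize (ofLex i).2 = k
  generalize (ofLex j).2 = l
  rw [emeryTau, Finset.sum_eq_single (plusAtomOf k l)]
  · -- the surviving atom
    simp only [emeryAtomPairCoef, cuO4SiteEquiv_symm_apply, ofLex_toLex, hopInd_eq_cast, uniformPeriodicWeight, superlatPlacementCount_plus_pair]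
    rw [show ((if (plusAtomOf k l).1 < 8 then (hopIndNat liebPeriods (emeryAtomCoset (plusAtomOf k l)) (emeryAtomVec (plusAtomOf k l)) (plusSite k)
        (plusSite l) : ℝ) else 0) : ℝ) = ((if (plusAtomOf k l).1 < 8 then hopIndNat liebPeriods (emeryAtomCoset (plusAtomOf k l))
        (emeryAtomVec (plusAtomOf k l)) (plusSite k) (plusSite l) else 0 : ℕ) : ℝ) by push_cast; rfl, hopIndNat_plus]
    fin_cases k <;> fin_cases l <;> simp [plusAtomOf, plusTau] <;> ring
  · -- every other atom contributes nothing
    intro a _ ha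
    simp only [emeryAtomPairCoef, cuO4SiteEquiv_symm_apply, ofLex_toLex, hopInd_eq_cast]
    rw [show ((if a.1 < 8 then (hopIndNat liebPeriods (emeryAtomCoset a) (emeryAtomVec a) (plusSite k) (plusSite l) : ℝ) else 0) : ℝ) =
        ((if a.1 < 8 then hopIndNat liebPeriods (emeryAtomCoset a) (emeryAtomVec a) (plusSite k) (plusSite l) else 0 : ℕ) : ℝ) by push_cast; rfl,
      hopIndNat_plus, if_neg (fun h => ha h.1)]
    simp
  · exact fun h => absurd (Finset.mem_univ _) h

/-- The repulsion coefficient at a concrete site, as a cast of naturals. [cite: ValentiStolzeHirschfeld1991, §II] -/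
private theorem emeryAtomUCoef_pt (w : Finset (Site 2) → ℝ) {Λ : Finset (Site 2)} (a : Fin 14) (x : Site 2) (hx : x ∈ Λ) :
    emeryAtomUCoef w Λ a (PolySite.pt x hx) =
      w {x} * ((emeryAtomUNat a * (if InCoset liebPeriods (emeryAtomCoset a) x then 1 else 0) : ℕ) : ℝ) := by
  unfold emeryAtomUCoef
  rw [PolySite.ofLex_coe_pt, emeryAtomU_eq_cast]
  push_cast
  ring

/-- The site-energy coefficient at a concrete site, as a cast of naturals. [cite: ValentiStolzeHirschfeld1991, §II] -/
private theorem emeryAtomECoef_pt (w : Finset (Site 2) → ℝ) {Λ : Finset (Site 2)} (a : Fin 14) (x : Site 2) (hx : x ∈ Λ) :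
    emeryAtomECoef w Λ a (PolySite.pt x hx) =
      w {x} * ((emeryAtomEpsNat a * (if InCoset liebPeriods (emeryAtomCoset a) x then 1 else 0) : ℕ) : ℝ) := by
  unfold emeryAtomECoef
  rw [PolySite.ofLex_coe_pt, emeryAtomEps_eq_cast]
  push_cast
  ring

/-- **The repulsion coefficients of the uniformly weighted plus are the table `plusUps`.** [cite: ValentiStolzeHirschfeld1991, §II] -/
theorem emeryUps_uniform_plus (i : Fin 1 ×ₗ Fin 5) :
    emeryUps (uniformPeriodicWeight liebPeriods emeryCuO4Window M) θ emeryCuO4Window (cuO4SiteEquiv.symm i) = plusUps θ M i := by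
  rw [lex_eq_toLex i]
  generalize (ofLex i).2 = k
  show emeryUps (uniformPeriodicWeight liebPeriods emeryCuO4Window M) θ emeryCuO4Window (PolySite.pt (plusSite k) (plusSite_mem k)) = _
  rw [emeryUps, Finset.sum_eq_single (plusUAtomOf k)]
  · rw [emeryAtomUCoef_pt, emeryAtomUNat_mul_coset_plus, if_pos rfl, uniformPeriodicWeight, superlatPlacementCount_plus_single]
    fin_cases k <;> simp [plusUAtomOf, plusUps] <;> ring
  · intro a _ ha
    rw [emeryAtomUCoef_pt, emeryAtomUNat_mul_coset_plus, if_neg ha]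
    simp
  · exact fun h => absurd (Finset.mem_univ _) h

/-- **The site-energy coefficients of the uniformly weighted plus are the table `plusNu`.** [cite: ValentiStolzeHirschfeld1991, §II] -/
theorem emeryNu_uniform_plus (i : Fin 1 ×ₗ Fin 5) :
    emeryNu (uniformPeriodicWeight liebPeriods emeryCuO4Window M) θ emeryCuO4Window (cuO4SiteEquiv.symm i) = plusNu θ M i := by
  rw [lex_eq_toLex i]
  generalize (ofLex i).2 = k
  show emeryNu (uniformPeriodicWeight liebPeriods emeryCuO4Window M) θ emeryCuO4Window (PolySite.pt (plusSite k) (plusSite_mem k)) = _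
  rw [emeryNu, Finset.sum_eq_single (plusEpsAtomOf k)]
  · rw [emeryAtomECoef_pt, emeryAtomEpsNat_mul_coset_plus, if_pos rfl, uniformPeriodicWeight, superlatPlacementCount_plus_single]
    fin_cases k <;> simp [plusEpsAtomOf, plusNu] <;> ring
  · intro a _ ha
    rw [emeryAtomECoef_pt, emeryAtomEpsNat_mul_coset_plus, if_neg ha]
    simp
  · exact fun h => absurd (Finset.mem_univ _) h

end Tables


/-! ### §4. The window certificate from kernel sector floors of `hubbardOpenBoxGP 1 5 (plusTau θ M) (plusUps θ M) (plusNu θ M)` -/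

section Final

variable (θ : Fin 14 → ℝ) (M : ℝ)

/-- **THE DICTIONARY (uniform weight of mass `M`)**: relabelled by rank, the uniformly reweighted three-band Hamiltonian on the plus IS
`hubbardOpenBoxGP 1 5 (plusTau θ M) (plusUps θ M) (plusNu θ M)`. [cite: ValentiStolzeHirschfeld1991, §II] [cite: PavariniEtAl2001, eq. (1)] -/
theorem relabel_cuO4_uniform_emeryInteraction :
    relabel (Orb.mapEquiv cuO4SiteEquiv)
        ((⟨fun X => (uniformPeriodicWeight liebPeriods emeryCuO4Window M X : ℂ) • (emeryInteraction θ).Φ X⟩ : FermionInteraction 2).localHamiltonian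
          emeryCuO4Window) =
      hubbardOpenBoxGP 1 5 (plusTau θ M) (plusUps θ M) (plusNu θ M) := by
  rw [relabel_cuO4_reweight_emeryInteraction]
  have hτ : (fun i j => emeryTau (uniformPeriodicWeight liebPeriods emeryCuO4Window M) θ emeryCuO4Window (cuO4SiteEquiv.symm i) (cuO4SiteEquiv.symm j)) =
      plusTau θ M := funext fun i => funext fun j => emeryTau_uniform_plus θ M i j
  have hυ : (fun i => emeryUps (uniformPeriodicWeight liebPeriods emeryCuO4Window M) θ emeryCuO4Window (cuO4SiteEquiv.symm i)) = plusUps θ M :=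
    funext fun i => emeryUps_uniform_plus θ M i
  have hν : (fun i => emeryNu (uniformPeriodicWeight liebPeriods emeryCuO4Window M) θ emeryCuO4Window (cuO4SiteEquiv.symm i)) = plusNu θ M :=
    funext fun i => emeryNu_uniform_plus θ M i
  rw [hτ, hυ, hν]

/-- `plusTau` is symmetric. [cite: ValentiStolzeHirschfeld1991, §II] -/
theorem plusTau_symm (i j : Fin 1 ×ₗ Fin 5) : plusTau θ M i j = plusTau θ M j i := by
  rw [← emeryTau_uniform_plus, ← emeryTau_uniform_plus, emeryTau_symm]

/-- **KERNEL SECTOR FLOORS ⇒ THE WINDOW CERTIFICATE.** If `q ≤ E₀(hubbardOpenBoxGP 1 5 (plusTau θ M) (plusUps θ M) (plusNu θ M), k)` for every particle number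
`k ≤ 10` — the output of hubbard-box-p2's `groundEnergy_ge_of_kCertsGP₃` / `kgp1x5_<tag>_floor_min` — then
`H^{w_M}_{W₅}[emeryInteraction θ] − q•1 ⪰ 0`, the `hq` hypothesis (with `G = 0`) of `le_emeryEnergyDensity_of_cuO4Certificate` and of the La₂CuO₄ order
`emeryBoxLa214v122_cuprate_energyFloor54_of_cuO4Certificates` (there `θ = emeryLine cuprateSigns (la214v122xCorner i) + μ i • levelDir`).
[cite: KullEtAl2024, §5.3] [cite: ValentiStolzeHirschfeld1991, §II] -/
theorem posSemidef_cuO4_uniform_sub_of_gpSectorFloors {q : ℝ}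
    (hq : ∀ k ≤ 10, q ≤ groundEnergy (hubbardOpenBoxGP 1 5 (plusTau θ M) (plusUps θ M) (plusNu θ M)) k) :
    (((⟨fun X => (uniformPeriodicWeight liebPeriods emeryCuO4Window M X : ℂ) • (emeryInteraction θ).Φ X⟩ : FermionInteraction 2).localHamiltonian
        emeryCuO4Window) - (q : ℂ) • (1 : FermionOp emeryCuO4Window)).PosSemidef := by
  have h := posSemidef_hubbardOpenBoxGP_sub_smul_one_of_sectors (plusTau θ M) (plusTau_symm θ M) (plusUps θ M) (plusNu θ M)
    (q := q) fun k hk => hq k (by simpa using hk)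
  have h' := posSemidef_relabel (Orb.mapEquiv cuO4SiteEquiv).symm h
  rw [map_sub, map_smul, relabel_one_generic, ← relabel_cuO4_uniform_emeryInteraction, relabel_symm_relabel] at h'
  exact h'

/-- The same with an explicit zero multiplier `G = 0` (the literal shape of the doors' `hq`). [cite: KullEtAl2024, §5.3] -/
theorem posSemidef_cuO4_uniform_add_zero_sub_of_gpSectorFloors {q : ℝ}
    (hq : ∀ k ≤ 10, q ≤ groundEnergy (hubbardOpenBoxGP 1 5 (plusTau θ M) (plusUps θ M) (plusNu θ M)) k) :
    (((⟨fun X => (uniformPeriodicWeight liebPeriods emeryCuO4Window M X : ℂ) • (emeryInteraction θ).Φ X⟩ : FermionInteraction 2).localHamiltonian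
        emeryCuO4Window) + (0 : FermionOp emeryCuO4Window) - (q : ℂ) • (1 : FermionOp emeryCuO4Window)).PosSemidef := by
  rw [add_zero]
  exact posSemidef_cuO4_uniform_sub_of_gpSectorFloors θ M hq

/-- The zero multiplier is killed by every state (the `hG0` hypothesis of the doors, for `G = 0`). [cite: KullEtAl2024, §5.3] -/
theorem re_expect_zero_cuO4 (ω' : InfVolFermionState 2) : (ω'.expect emeryCuO4Window (0 : FermionOp emeryCuO4Window)).re = 0 := by
  rw [map_zero, Complex.zero_re]

end Final

end Literature.MathematicalPhysics.QuantumLattice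

end
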